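import Mathlib
import HarnessLib
import Summits.NavierStokesRegularity.NavierStokesRegularity.Theorems.SymmetryModuliCountStretchingCertificateComparisonKato
import Summits.NavierStokesRegularity.NavierStokesRegularity.Theorems.SymmetryModuliCountStretchingCertificateComparisonMaxPrinciple
import Literature.Analysis.FluidPDE.GigaMiura2011ScaledAlignmentBlowupLimitHolds
import Literature.Analysis.FluidPDE.KNSSTypeIRateLiouvilleMild
import Literature.Analysis.FluidPDE.NSBoundedMildOseenClassical
import Literature.Analysis.FluidPDE.AncientMildCompactness
import Literature.Analysis.FluidPDE.TypeIAncientMild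

/-!
# TypeILiouvilleStrainLedgerExtinction — crux (L) stmt-NavierStokesRegularity-10661 `TypeIliouvilleL`,
# registered stub `stub_quiescentLiouville` (L_Q): THE VISCOUS VORTICITY-AMPLIFICATION BOUND ON PRINT'S CLASS

Helper for stmt-NavierStokesRegularity-10661 (`--supports`); theorems only, no definitions, no named-fact
hypotheses; closes no item; Navier–Stokes regularity is NOT proved here.  Kernel source: the decomp-ns cell's
lens-2 g17 node «THE STRAIN LEDGER» (`run/shared/lean/pub/decomp-ns/decomp-ns-lens-2/StrainLedger.lean`,
critic row 200 CLEARED, «BANK as Theorems --supports 10661»), banked here DEF-FREE (the node's `VorticityExtinction`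
/ `IsStrainMajorantOn` are unfolded into hypotheses) by the leafhand seat of the EulerZoomLiouville route.

PRINT'S CLASS P (KNSS 2009 §4 (i); the right-hand side of the tree's `TypeIliouvilleL_iff_oseenMild_liouville`):
a field `v : ℝ → ℝ³ → ℝ³` continuous and bounded on `(−∞,0) × ℝ³`, weakly divergence free, solving the Oseen
integral equation `v(t) = e^{(t−s)Δ}v(s) − B¹_s(v,v)(t)` for all `s < t < 0`.

* §1 `classP_exists_isClassicalNSSolutionOn_Ioo` — class P is CLASSICAL on every window `(t₀,0)` (class-P twin of
  the tree's `IsTypeIAncientMild.exists_isClassicalNSSolutionOn_Ioo`; Fabes–Jones–Rivière via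
  `classical_of_smooth_isMildNSSolutionOn_holds`); `classP_vorticity_eq` — the pointwise vorticity equation
  `∂_t ω + (v·∇)ω = (∇v) ω + Δω` on `(−∞,0) × ℝ³`.
* §2 `norm_curl_le_mul_exp_integral_strain` — **VE, THE STRAIN LEDGER BOUND**: for a window `[s,t] ⊂ (−∞,0)`,
  a continuous STRAIN MAJORANT `Λ` on it (`⟪∇v(τ,x) ξ, ξ⟫ ≤ Λ τ ‖ξ‖²`, i.e. `λ_max(S) ≤ Λ`) and a vorticity bound
  `‖ω(s,·)‖ ≤ Ω₀` at its start, `‖ω(t,x)‖ ≤ Ω₀ · exp ∫_s^t Λ`.  Mechanism: the gauged enstrophy density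
  `e^{−2∫_s^τ Λ}‖ω‖²` is a bounded subsolution of the drift–diffusion operator (defect
  `2e^{−2∫Λ}(⟪Sω,ω⟫ − Λ|ω|² − |∇ω|²_F) ≤ 0`), so the tree's weak maximum principle `le_of_subsolution_linear_drift`
  applies.  Forward prototype in print: Majda–Bertozzi, *Vorticity and Incompressible Flow*, eq. (3.80); inviscid
  Lagrangian sibling in tree: `Literature.Analysis.FluidPDE.VorticityAmplificationBound`.
  `norm_curl_le_mul_exp_integral_norm_fderiv` — the same with the plain gradient majorant `‖∇v(τ,x)‖ ≤ g τ`.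

READING for L_Q (with `TypeILiouvilleQuiescentGradient`: quiescent ⟺ `sup_x ‖∇v(t,·)‖ → 0`): the gauged vorticity
maximum `e^{−∫Λ} sup_x‖ω‖` is MONOTONE on class P; a non-constant member needs a DIVERGENT backward strain ledger
(companion file `TypeILiouvilleStrainLedgerStarved`).  [cite: KochNadirashviliSereginSverak2009, §4 (arXiv:0709.3599);
MajdaBertozzi2002, eq. (3.80)]
-/

noncomputable section
open MeasureTheory Filter Set Function Metric
open scoped Topology RealInnerProductSpace ContDiff Laplacian ENNReal NNReal
open Literature.Analysis Literature.Analysis.FluidPDE Literature.Analysis.UnboundedOperators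
set_option linter.dupNamespace false
namespace Summit.NavierStokesRegularity.NavierStokesRegularity.Theorems.TypeILiouvilleStrainLedger

/-! ## §1 Class P is classical on windows; the vorticity equation -/

/-- Class P is classical on every window `(t₀, 0)` (class-P twin of the tree's
`IsTypeIAncientMild.exists_isClassicalNSSolutionOn_Ioo`; Fabes–Jones–Rivière 1972, Thm. 2.1, through the tree's
`classical_of_smooth_isMildNSSolutionOn_holds`). [cite: KochNadirashviliSereginSverak2009, §4 (arXiv:0709.3599)] -/
theorem classP_exists_isClassicalNSSolutionOn_Ioo
    {v : ℝ → EuclideanSpace ℝ (Fin 3) → EuclideanSpace ℝ (Fin 3)}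
    (hc : ContinuousOn (uncurry v) (Iio 0 ×ˢ univ))
    (hK : ∃ K : ℝ, ∀ t < 0, ∀ x, ‖v t x‖ ≤ K)
    (hd : ∀ t < 0, IsWeaklyDivFree (v t))
    (hm : ∀ s t : ℝ, s < t → t < 0 → ∀ x,
      v t x = heatExtension (v s) (t - s) x - oseenDuhamel 1 s v v t x)
    {t₀ : ℝ} (ht₀ : t₀ < 0) :
    ∃ p : ℝ → EuclideanSpace ℝ (Fin 3) → ℝ, IsClassicalNSSolutionOn (Ioo t₀ 0) 1 0 v p := by
  have hT : 0 < -t₀ := neg_pos.2 ht₀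
  obtain ⟨K, hKb⟩ := hK
  have hmild1 : ∀ s t : ℝ, s < t → t < 0 → ∀ x,
      v t x = heatExtension (v s) (1 * (t - s)) x - oseenDuhamel 1 s v v t x := by
    intro s t hst ht x; rw [one_mul]; exact hm s t hst ht x
  have hB : IsBoundedAncientMildSolution 1 v :=
    isBoundedAncientMildSolution_of_oseen one_pos hc ⟨K, hKb⟩ hd hmild1
  obtain ⟨hsmI', -⟩ := smooth_and_bounds_of_bounded_ancient_oseenMild hc hd hm hKb
  have hsmI : IsSmoothSpaceTimeOn (Iio 0) v := hsmI'
  set w : ℝ → EuclideanSpace ℝ (Fin 3) → EuclideanSpace ℝ (Fin 3) := fun t => v (t + t₀) with hw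
  have hmild : IsMildNSSolutionOn (Ioo 0 (-t₀)) 1 0 (v t₀) w :=
    (hB.isAncientMildSolution.isMildNSSolutionOn_translate t₀).mono Ioo_subset_Ico_self
  have hsm : IsSmoothSpaceTimeOn (Ioo 0 (-t₀)) w := by
    refine (hsmI.comp_add_right t₀).mono fun t ht => ?_
    simp only [mem_preimage, mem_Iio]
    linarith [ht.2]
  have hbdd : ∀ T₁ ∈ Ioo 0 (-t₀), ∃ K' : ℝ≥0∞, K' < ⊤ ∧
      ∀ t ∈ Ioo 0 T₁, eLpNorm (w t) ∞ volume ≤ K' := by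
    intro T₁ hT₁
    refine ⟨ENNReal.ofReal K, ENNReal.ofReal_lt_top, fun t ht => ?_⟩
    rw [eLpNorm_exponent_top]
    refine eLpNormEssSup_le_of_ae_bound (Eventually.of_forall fun x => ?_)
    have htt : t + t₀ < 0 := by linarith [ht.2, hT₁.2]
    exact hKb (t + t₀) htt x
  have hvc0 : Continuous (v t₀) :=
    hc.comp_continuous (f := fun x : EuclideanSpace ℝ (Fin 3) => (t₀, x)) (by fun_prop)
      fun x => ⟨ht₀, mem_univ _⟩
  have hu₀m : AEStronglyMeasurable (v t₀) volume := hvc0.aestronglyMeasurable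
  have hu₀G : ∀ a : ℝ, 0 < a →
      Integrable (fun y => UnboundedOperators.heatKernel a y * ‖v t₀ y‖) volume := by
    intro a ha
    have hKi : Integrable (UnboundedOperators.heatKernel (E := EuclideanSpace ℝ (Fin 3)) a) volume :=
      UnboundedOperators.integrable_heatKernel_holds ha
    have h := hKi.bdd_mul (c := K) hu₀m.norm
      (Eventually.of_forall fun y => by rw [norm_norm]; exact hKb t₀ ht₀ y)
    refine h.congr (Eventually.of_forall fun y => ?_)
    simp only [mul_comm]
  obtain ⟨q, hcl⟩ := classical_of_smooth_isMildNSSolutionOn_holds (EuclideanSpace ℝ (Fin 3))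
    one_pos hT hu₀m hu₀G hsm hbdd hmild
  refine ⟨fun t => q (t - t₀), ?_⟩
  have h1 := hcl.comp_add_right (-t₀)
  have hset : (fun t : ℝ => t + -t₀) ⁻¹' Ioo 0 (-t₀) = Ioo t₀ 0 := by
    ext t
    simp only [mem_preimage, mem_Ioo]
    constructor
    · rintro ⟨h1, h2⟩; exact ⟨by linarith, by linarith⟩
    · rintro ⟨h1, h2⟩; exact ⟨by linarith, by linarith⟩
  rw [hset] at h1
  have hf : (fun t : ℝ => (0 : ℝ → EuclideanSpace ℝ (Fin 3) → EuclideanSpace ℝ (Fin 3)) (t + -t₀)) = 0 := by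
    funext t; rfl
  have hu' : (fun t : ℝ => w (t + -t₀)) = v := by
    funext t; simp only [hw]; congr 1; ring
  have hp' : (fun t : ℝ => q (t + -t₀)) = fun t => q (t - t₀) := by
    funext t; rw [← sub_eq_add_neg]
  rw [hf, hu', hp'] at h1
  exact h1

/-- The vorticity equation of a class-P flow at every point of `(−∞,0) × ℝ³`:
`∂_t ω + (∇ω) v = (∇v) ω + Δω` (class-P twin of the tree's Type-I version; Majda–Bertozzi (2.110)).
[cite: MajdaBertozzi2002, eq. (2.110)] -/
theorem classP_vorticity_eq
    {v : ℝ → EuclideanSpace ℝ (Fin 3) → EuclideanSpace ℝ (Fin 3)}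
    (hc : ContinuousOn (uncurry v) (Iio 0 ×ˢ univ))
    (hK : ∃ K : ℝ, ∀ t < 0, ∀ x, ‖v t x‖ ≤ K)
    (hd : ∀ t < 0, IsWeaklyDivFree (v t))
    (hm : ∀ s t : ℝ, s < t → t < 0 → ∀ x,
      v t x = heatExtension (v s) (t - s) x - oseenDuhamel 1 s v v t x)
    {t : ℝ} (ht : t < 0) (x : EuclideanSpace ℝ (Fin 3)) :
    deriv (fun s => curl (v s) x) t + fderiv ℝ (curl (v t)) x (v t x) =
      fderiv ℝ (v t) x (curl (v t) x) + (Δ (curl (v t))) x := by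
  have h2t : 2 * t < 0 := by linarith
  obtain ⟨p, hcl⟩ := classP_exists_isClassicalNSSolutionOn_Ioo hc hK hd hm h2t
  have ht' : t ∈ Ioo (2 * t) 0 := ⟨by linarith, ht⟩
  have hveq := (hcl.isVorticitySolutionOn_zero_force isOpen_Ioo.uniqueDiffOn
    (by rw [interior_Ioo]; exact subset_closure)).vorticity_eq t ht' x
  simp only [timeDerivWithin_eq_deriv isOpen_Ioo ht', convect_apply, vorticity_apply,
    one_smul] at hveq
  exact hveq

/-! ## §2 VE — the strain ledger bounds the vorticity -/

/-- **VE — THE VISCOUS VORTICITY-AMPLIFICATION BOUND ON PRINT'S CLASS (the strain ledger).**  For a class-P flow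
`v`, a window `[s,t] ⊂ (−∞,0)`, a continuous strain majorant `Λ` on it (`⟪∇v(τ,x) ξ, ξ⟫ ≤ Λ τ · ‖ξ‖²` for
`τ ∈ [s,t]`) and an initial vorticity bound `‖curl v(s,·)‖ ≤ Ω₀`: `‖curl v(t,x)‖ ≤ Ω₀ · exp ∫_s^t Λ`.  Proof: weak
maximum principle (`le_of_subsolution_linear_drift`, drift constant `‖v‖_∞`) for the gauged enstrophy density
`P(τ,y) = e^{−2∫_s^τ Λ} ‖ω(τ,y)‖²`, whose parabolic defect `2e^{−2∫Λ}(⟪∇v ω, ω⟫ − Λ‖ω‖² − ‖∇ω‖²_F)` is `≤ 0`.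
[cite: MajdaBertozzi2002, eq. (3.80) (forward prototype); KochNadirashviliSereginSverak2009, §4] -/
theorem norm_curl_le_mul_exp_integral_strain
    {v : ℝ → EuclideanSpace ℝ (Fin 3) → EuclideanSpace ℝ (Fin 3)}
    (hc : ContinuousOn (uncurry v) (Iio 0 ×ˢ univ))
    (hK : ∃ K : ℝ, ∀ t < 0, ∀ x, ‖v t x‖ ≤ K)
    (hd : ∀ t < 0, IsWeaklyDivFree (v t))
    (hm : ∀ s t : ℝ, s < t → t < 0 → ∀ x,
      v t x = heatExtension (v s) (t - s) x - oseenDuhamel 1 s v v t x)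
    {s t : ℝ} (hst : s < t) (ht : t < 0) {Λ : ℝ → ℝ} (hΛc : Continuous Λ)
    (hΛ : ∀ τ ∈ Icc s t, ∀ x ξ : EuclideanSpace ℝ (Fin 3), ⟪fderiv ℝ (v τ) x ξ, ξ⟫ ≤ Λ τ * ‖ξ‖ ^ 2)
    {Ω₀ : ℝ} (hΩ : ∀ x, ‖curl (v s) x‖ ≤ Ω₀) (x : EuclideanSpace ℝ (Fin 3)) :
    ‖curl (v t) x‖ ≤ Ω₀ * Real.exp (∫ τ in s..t, Λ τ) := by
  obtain ⟨K, hKb⟩ := hK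
  have hK0 : 0 ≤ K := (norm_nonneg _).trans (hKb (-1) (by norm_num) 0)
  have hΩ0 : 0 ≤ Ω₀ := (norm_nonneg _).trans (hΩ x)
  obtain ⟨hsm', hbounds⟩ := smooth_and_bounds_of_bounded_ancient_oseenMild hc hd hm hKb
  have hsm : IsSmoothSpaceTimeOn (Iio 0) v := hsm'
  have hvort : IsSmoothSpaceTimeOn (Iio 0) (vorticity v) := isSmoothSpaceTimeOn_vorticity_Iio hsm
  -- uniform vorticity bound `‖ω‖ ≤ ‖curlCLM‖ C₁`
  obtain ⟨C₁, hC₁⟩ := hbounds 1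
  have hωbd : ∀ τ < 0, ∀ y, ‖curl (v τ) y‖ ≤ ‖curlCLM‖ * C₁ := by
    intro τ hτ y
    have h1 : ‖fderiv ℝ (v τ) y‖ ≤ C₁ := by
      have := hC₁ τ hτ y; rwa [norm_iteratedFDeriv_one] at this
    calc ‖curl (v τ) y‖ = ‖curlCLM (fderiv ℝ (v τ) y)‖ := rfl
      _ ≤ ‖curlCLM‖ * ‖fderiv ℝ (v τ) y‖ := ContinuousLinearMap.le_opNorm _ _
      _ ≤ ‖curlCLM‖ * C₁ := mul_le_mul_of_nonneg_left h1 (norm_nonneg curlCLM)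
  -- the temporal gauge `G τ = ∫_s^τ Λ`, `G' = Λ`, `G s = 0`
  set G : ℝ → ℝ := fun τ => ∫ r in s..τ, Λ r with hG_def
  have hG : ∀ τ, HasDerivAt G (Λ τ) τ := fun τ =>
    intervalIntegral.integral_hasDerivAt_right (hΛc.intervalIntegrable _ _)
      (hΛc.stronglyMeasurableAtFilter _ _) hΛc.continuousAt
  have hGc : Continuous G := continuous_iff_continuousAt.2 fun τ => (hG τ).continuousAt
  have hGs : G s = 0 := by simp [hG_def]
  -- the gauged enstrophy density and its time derivative
  set P : ℝ → EuclideanSpace ℝ (Fin 3) → ℝ :=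
    fun τ y => Real.exp (-2 * G τ) * ‖curl (v τ) y‖ ^ 2 with hP_def
  set Pt : ℝ → EuclideanSpace ℝ (Fin 3) → ℝ := fun τ y =>
    Real.exp (-2 * G τ) * (-2 * Λ τ) * ‖curl (v τ) y‖ ^ 2 +
      Real.exp (-2 * G τ) * (2 * ⟪curl (v τ) y, deriv (fun r => curl (v r) y) τ⟫) with hPt_def
  have hE : ∀ τ, HasDerivAt (fun r => Real.exp (-2 * G r)) (Real.exp (-2 * G τ) * (-2 * Λ τ)) τ :=
    fun τ => ((hG τ).const_mul (-2)).exp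
  have hIcc : Icc s t ⊆ Iio 0 := fun τ hτ => lt_of_le_of_lt hτ.2 ht
  -- a bound for `G` on the window
  obtain ⟨M, hM⟩ := isCompact_Icc.exists_bound_of_continuousOn (hGc.continuousOn (s := Icc s t))
  -- the weak maximum principle
  have hmp := le_of_subsolution_linear_drift (T₁ := s) (T₂ := t) (M := Ω₀ ^ 2)
    (B := Real.exp (2 * M) * (‖curlCLM‖ * C₁) ^ 2) hK0 (P := P) (Pₜ := Pt) ?hc ?h2 ?ht ?hsub ?hB ?hM
  case hc =>
    have h1 : ContinuousOn (fun p : ℝ × EuclideanSpace ℝ (Fin 3) => ‖uncurry (vorticity v) p‖ ^ 2)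
        (Icc s t ×ˢ univ) :=
      ((hvort.continuousOn.mono (prod_mono hIcc Subset.rfl)).norm).pow 2
    have h2 : ContinuousOn (fun p : ℝ × EuclideanSpace ℝ (Fin 3) => Real.exp (-2 * G p.1))
        (Icc s t ×ˢ univ) :=
      ((Real.continuous_exp.comp ((continuous_const.mul hGc).comp continuous_fst))).continuousOn
    exact (h2.mul h1).congr fun p _ => rfl
  case h2 =>
    intro τ hτ
    have hOm : ContDiff ℝ 2 (curl (v τ)) :=
      (hvort.contDiff_slice (hIcc ⟨hτ.1.le, hτ.2⟩)).of_le (by norm_cast)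
    exact contDiff_const.mul ((contDiff_norm_sq ℝ).comp hOm)
  case ht =>
    intro τ hτ y
    have hτ0 : τ ∈ Iio (0 : ℝ) := hIcc ⟨hτ.1.le, hτ.2⟩
    have hOmt : HasDerivAt (fun r => curl (v r) y) (deriv (fun r => curl (v r) y) τ) τ :=
      hvort.hasDerivAt_timeLine isOpen_Iio hτ0 y
    have hqt : HasDerivAt (fun r => ‖curl (v r) y‖ ^ 2)
        (2 * ⟪curl (v τ) y, deriv (fun r => curl (v r) y) τ⟫) τ := hOmt.norm_sq
    exact (hE τ).mul hqt
  case hB =>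
    intro τ hτ y
    have hτ0 : τ < 0 := hIcc hτ
    have hGτ : -2 * G τ ≤ 2 * M := by
      have := hM τ hτ; rw [Real.norm_eq_abs] at this
      have := neg_abs_le (G τ); linarith
    have h1 : Real.exp (-2 * G τ) ≤ Real.exp (2 * M) := Real.exp_le_exp.2 hGτ
    have h2 : ‖curl (v τ) y‖ ^ 2 ≤ (‖curlCLM‖ * C₁) ^ 2 :=
      pow_le_pow_left₀ (norm_nonneg _) (hωbd τ hτ0 y) 2
    exact mul_le_mul h1 h2 (sq_nonneg _) (Real.exp_pos _).le
  case hM =>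
    intro y
    have h2 : ‖curl (v s) y‖ ^ 2 ≤ Ω₀ ^ 2 := pow_le_pow_left₀ (norm_nonneg _) (hΩ y) 2
    simp only [hP_def, hGs, mul_zero, Real.exp_zero, one_mul]
    exact h2
  case hsub =>
    intro τ hτ y
    have hτ0 : τ < 0 := hIcc ⟨hτ.1.le, hτ.2⟩
    have hτ0' : τ ∈ Iio (0 : ℝ) := hτ0
    -- abbreviations
    set c : ℝ := Real.exp (-2 * G τ) with hc_def
    have hc0 : 0 < c := Real.exp_pos _
    have hOm : ContDiff ℝ 2 (curl (v τ)) := (hvort.contDiff_slice hτ0').of_le (by norm_cast)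
    have hOmd : DifferentiableAt ℝ (curl (v τ)) y := (hOm.differentiable two_ne_zero) y
    have hq2 : ContDiff ℝ 2 (fun z => ‖curl (v τ) z‖ ^ 2) := (contDiff_norm_sq ℝ).comp hOm
    have hqd : DifferentiableAt ℝ (fun z => ‖curl (v τ) z‖ ^ 2) y := (hq2.differentiable two_ne_zero) y
    -- spatial derivatives of the slice `P τ = c • |ω|²`
    have hPslice : P τ = fun z => c * ‖curl (v τ) z‖ ^ 2 := rfl
    have hfd : ∀ w, fderiv ℝ (P τ) y w = c * (2 * ⟪curl (v τ) y, fderiv ℝ (curl (v τ)) y w⟫) := by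
      intro w
      rw [hPslice, fderiv_const_mul hqd, FunLike.coe_smul, Pi.smul_apply, smul_eq_mul,
        fderiv_norm_sq_comp_apply hOmd w]
    have hΔ : (Δ (P τ)) y =
        c * (2 * ⟪(Δ (curl (v τ))) y, curl (v τ) y⟫ + 2 * frobeniusNormSq (fderiv ℝ (curl (v τ)) y)) := by
      have h1 : (Δ (c • fun z => ‖curl (v τ) z‖ ^ 2)) y = c • (Δ fun z => ‖curl (v τ) z‖ ^ 2) y :=
        InnerProductSpace.laplacian_smul c hq2.contDiffAt
      have h2 : (c • fun z => ‖curl (v τ) z‖ ^ 2) = P τ := by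
        funext z; simp [hPslice, smul_eq_mul]
      rw [← h2, h1, smul_eq_mul, laplacian_norm_sq_comp hOm y]
    -- the vorticity equation at `(τ, y)`
    have hveq := classP_vorticity_eq hc ⟨K, hKb⟩ hd hm hτ0 y
    -- the stretching term is majorised: `⟪Dv ω, ω⟫ ≤ Λ ‖ω‖²`
    have hstr : ⟪fderiv ℝ (v τ) y (curl (v τ) y), curl (v τ) y⟫ ≤ Λ τ * ‖curl (v τ) y‖ ^ 2 :=
      hΛ τ ⟨hτ.1.le, hτ.2⟩ y (curl (v τ) y)
    -- the transport term is a drift: `|DP(y) u| ≤ K ‖DP(y)‖`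
    have hdrift : -(fderiv ℝ (P τ) y (v τ y)) ≤ K * (1 + ‖y‖) * ‖fderiv ℝ (P τ) y‖ := by
      have h1 : |fderiv ℝ (P τ) y (v τ y)| ≤ ‖fderiv ℝ (P τ) y‖ * ‖v τ y‖ := by
        rw [← Real.norm_eq_abs]; exact ContinuousLinearMap.le_opNorm _ _
      have h2 : ‖fderiv ℝ (P τ) y‖ * ‖v τ y‖ ≤ ‖fderiv ℝ (P τ) y‖ * K :=
        mul_le_mul_of_nonneg_left (hKb τ hτ0 y) (norm_nonneg _)
      have h3 : ‖fderiv ℝ (P τ) y‖ * K ≤ K * (1 + ‖y‖) * ‖fderiv ℝ (P τ) y‖ := by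
        nlinarith [mul_nonneg (mul_nonneg hK0 (norm_nonneg y)) (norm_nonneg (fderiv ℝ (P τ) y))]
      linarith [neg_abs_le (fderiv ℝ (P τ) y (v τ y))]
    -- assemble: `Pt = -2cΛ|ω|² + 2c⟪ω, ω'⟫`, `ω' = Dv ω + Δω - Dω u`
    have hωt : deriv (fun r => curl (v r) y) τ =
        fderiv ℝ (v τ) y (curl (v τ) y) + (Δ (curl (v τ))) y - fderiv ℝ (curl (v τ)) y (v τ y) := by
      rw [← hveq]; abel
    have hPt : Pt τ y = c * (-2 * Λ τ) * ‖curl (v τ) y‖ ^ 2 +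
        c * (2 * ⟪curl (v τ) y, deriv (fun r => curl (v r) y) τ⟫) := rfl
    rw [hPt, hωt, inner_sub_right, inner_add_right, hΔ]
    have hfdv := hfd (v τ y)
    rw [hfdv] at hdrift
    have hF := frobeniusNormSq_nonneg (fderiv ℝ (curl (v τ)) y)
    have hcomm1 : ⟪curl (v τ) y, fderiv ℝ (v τ) y (curl (v τ) y)⟫ =
        ⟪fderiv ℝ (v τ) y (curl (v τ) y), curl (v τ) y⟫ := real_inner_comm _ _
    have hcomm2 : ⟪curl (v τ) y, (Δ (curl (v τ))) y⟫ = ⟪(Δ (curl (v τ))) y, curl (v τ) y⟫ :=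
      real_inner_comm _ _
    rw [hcomm1, hcomm2]
    nlinarith [mul_nonneg hc0.le hF, mul_le_mul_of_nonneg_left hstr hc0.le]
  -- conclusion at `(t, x)`
  have hPt_le : P t x ≤ Ω₀ ^ 2 := hmp t ⟨hst.le, le_rfl⟩ x
  have hsq : ‖curl (v t) x‖ ^ 2 ≤ (Ω₀ * Real.exp (G t)) ^ 2 := by
    have h1 : Real.exp (-2 * G t) * ‖curl (v t) x‖ ^ 2 ≤ Ω₀ ^ 2 := hPt_le
    have h2 : Real.exp (-2 * G t) * Real.exp (G t) ^ 2 = 1 := by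
      rw [← Real.exp_nat_mul, ← Real.exp_add]; norm_num
    nlinarith [Real.exp_pos (G t), sq_nonneg (Real.exp (G t))]
  have hfin : ‖curl (v t) x‖ ≤ Ω₀ * Real.exp (G t) :=
    (pow_le_pow_iff_left₀ (norm_nonneg _) (mul_nonneg hΩ0 (Real.exp_pos _).le) two_ne_zero).1 hsq
  simpa [hG_def] using hfin

/-- **VE with the plain gradient majorant.**  If `‖∇v(τ,x)‖ ≤ g τ` on the window `[s,t] ⊂ (−∞,0)` for a continuous
`g`, then `‖curl v(t,x)‖ ≤ Ω₀ · exp ∫_s^t g` for any bound `‖curl v(s,·)‖ ≤ Ω₀` (Cauchy–Schwarz: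
`⟪∇v ξ, ξ⟫ ≤ ‖∇v‖ ‖ξ‖²`).  This is the currency of `TypeILiouvilleQuiescentGradient` (quiescent ⟺ `sup_x‖∇v‖ → 0`).
[cite: MajdaBertozzi2002, eq. (3.80)] -/
theorem norm_curl_le_mul_exp_integral_norm_fderiv
    {v : ℝ → EuclideanSpace ℝ (Fin 3) → EuclideanSpace ℝ (Fin 3)}
    (hc : ContinuousOn (uncurry v) (Iio 0 ×ˢ univ))
    (hK : ∃ K : ℝ, ∀ t < 0, ∀ x, ‖v t x‖ ≤ K)
    (hd : ∀ t < 0, IsWeaklyDivFree (v t))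
    (hm : ∀ s t : ℝ, s < t → t < 0 → ∀ x,
      v t x = heatExtension (v s) (t - s) x - oseenDuhamel 1 s v v t x)
    {s t : ℝ} (hst : s < t) (ht : t < 0) {g : ℝ → ℝ} (hgc : Continuous g)
    (hg : ∀ τ ∈ Icc s t, ∀ x : EuclideanSpace ℝ (Fin 3), ‖fderiv ℝ (v τ) x‖ ≤ g τ)
    {Ω₀ : ℝ} (hΩ : ∀ x, ‖curl (v s) x‖ ≤ Ω₀) (x : EuclideanSpace ℝ (Fin 3)) :
    ‖curl (v t) x‖ ≤ Ω₀ * Real.exp (∫ τ in s..t, g τ) := by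
  refine norm_curl_le_mul_exp_integral_strain hc hK hd hm hst ht hgc (fun τ hτ y ξ => ?_) hΩ x
  calc ⟪fderiv ℝ (v τ) y ξ, ξ⟫ ≤ ‖fderiv ℝ (v τ) y ξ‖ * ‖ξ‖ := real_inner_le_norm _ _
    _ ≤ (‖fderiv ℝ (v τ) y‖ * ‖ξ‖) * ‖ξ‖ :=
        mul_le_mul_of_nonneg_right (ContinuousLinearMap.le_opNorm _ _) (norm_nonneg _)
    _ ≤ (g τ * ‖ξ‖) * ‖ξ‖ :=
        mul_le_mul_of_nonneg_right (mul_le_mul_of_nonneg_right (hg τ hτ y) (norm_nonneg _)) (norm_nonneg _)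
    _ = g τ * ‖ξ‖ ^ 2 := by ring

end Summit.NavierStokesRegularity.NavierStokesRegularity.Theorems.TypeILiouvilleStrainLedger

end
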